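import Summits.BirchSwinnertonDyer.BirchSwinnertonDyer.Theorems.KolyvaginDepthDoorMSymbolCert709a1Twist
import Summits.BirchSwinnertonDyer.BirchSwinnertonDyer.Theorems.KolyvaginDepthDoorDepthTableKuriharaRow389a1CertifiedT
import Summits.BirchSwinnertonDyer.BirchSwinnertonDyer.Theorems.KolyvaginDepthDoorDepthTableKuriharaRow709a1CertifiedE
import Summits.BirchSwinnertonDyer.BirchSwinnertonDyer.Theorems.KolyvaginDepthDoorDepthTableKuriharaSocket709a1
import Summits.BirchSwinnertonDyer.BirchSwinnertonDyer.Theorems.KolyvaginDepthDoorDepthTableKuriharaDecisive709a1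
import Literature.NumberTheory.EllipticCurves.BurungaleSkinnerTianWan2024.CyclotomicPConverseOverQProofs
import HarnessLib

/-!
# Route `KolyvaginDepthDoor`, crux `KolyvaginDepthSupplyKN` (stmt-BirchSwinnertonDyer-22820) —
# DEPTH TABLE v27: row `709a1` @ `(5, −7)` with BOTH Kurihara claims PROVED

Helper file of the lead prover of line `levelone` (kdd-p1 g31; `--supports stmt-BirchSwinnertonDyer-22820
--as helper`); it closes nothing and BSD is NOT proved by it. Sibling of `…KuriharaRow389a1CertifiedT` for another
rank-two row of the depth table:
* §1 the Kurihara data of `T₀ = 709a1 ⊗ χ₋₇` at `(5, 71)` (logarithm table mod `71`; the twisted minus sums `sigmaT` of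
  `…MSymbolCert709a1Twist`; `kSumT ≢ 0 (mod 5)` by `decide`);
* §2 `exists_kuriharaNumber_ne_zero_T0`: for every parametrisation datum of `T₀` at level `34741` the Kurihara
  number at `(5, 71)` is non-zero — the line `[r]⁺_g ∈ C ℤ` through `1/2` (`exists_mul_eq_half`) and the
  integrality of `[2/71]⁺_g = (-1) C` (`T₀[5]` irreducible, transported from `709a1` through the twist) make `C`
  a `5`-adic unit (`kuriharaNumber_ne_zero_of_const`);
* §3 `C709a1.kuriharaClaimT_5_71` — the twist-side Kurihara claim of the row VERBATIM, from modularity by name;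
  `C709a1.cruxBody_of_print_5_neg7` — the row with both claims discharged (`C709a1.kuriharaClaim_5_7171` is the
  kernel-certified E-side), conditional on the four print facts only.

References: [Kim2022StructureSelmer] Thm. 1.11, §1.4.3; [MazurTateTeitelbaum1986Invent] §I.8; [CremonaAlgorithms1997]
§2.8, Table 1 (709a1); [WZhang2014] L8.4 (1), Thm. 9.1; [Mazur1978] Cor. 4.1.
-/

set_option linter.dupNamespace false

noncomputable section

open scoped MatrixGroups ModularForm Classical NumberField
open CongruenceSubgroup
open Literature.NumberTheory.EllipticCurves Literature.NumberTheory.EllipticCurves.ModularForms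
open Literature.NumberTheory.EllipticCurves.BurungaleSkinnerTianWan2024
  (hasIrreducibleModPGaloisRep_of_smul_eq_quadraticTwist)
open Summit.BirchSwinnertonDyer.BirchSwinnertonDyer.Rank2Observatory
open Summit.BirchSwinnertonDyer.BirchSwinnertonDyer.Theorems.KolyvaginDepthDoor.MSymbolCert.Cert389a1
  (exists_mul_eq_half kuriharaNumber_ne_zero_of_const)

namespace Summit.BirchSwinnertonDyer.BirchSwinnertonDyer.Theorems.KolyvaginDepthDoor.MSymbolCert.Cert709a1

/-! ## §1 The Kurihara data of `T₀` at `(5, 71)` -/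

/-- The table family for `n = 71`. [folklore] -/
def T71 (ℓ : ℕ) : List ℕ := if ℓ = 71 then tab71 else []

/-- Admissibility of the table family. [folklore] -/
theorem T71_ok : ∀ ℓ, T71 ℓ = [] ∨ (ℓ.Prime ∧ tabOK ℓ 5 (T71 ℓ) = true) := by
  intro ℓ
  by_cases h : ℓ = 71
  · right
    rw [h, T71, if_pos rfl]
    exact ⟨by norm_num, tabOK_71⟩
  · left; simp [T71, h]

/-- `71` is prime: `(71).primeFactors = {71}`. [folklore] -/
theorem primeFactors_71 : (71 : ℕ).primeFactors = {71} := Nat.Prime.primeFactors (by norm_num)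

/-- Surjectivity at the prime factors of `71`. [folklore] -/
theorem T71_surj : ∀ ℓ ∈ (71 : ℕ).primeFactors, tabSurj ℓ 5 (T71 ℓ) = true := by
  rw [primeFactors_71]
  intro ℓ hℓ
  rw [Finset.mem_singleton] at hℓ
  rw [hℓ, T71, if_pos rfl]
  exact tabSurj_71

/-- The unit witness `sigmaT 2 = -1` (decide). [folklore] -/
theorem sigmaT_witness : sigmaT 2 = -1 := by
  decide +kernel

/-- **The twisted Kurihara sum is `≢ 0 (mod 5)`** (decide: `≡ 2`).
[cite: Kim2022StructureSelmer, §1.4.3] -/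
theorem kSumT_ne_zero : kSum 5 71 sigmaT (71 : ℕ).primeFactors T71 ≠ 0 := by
  rw [primeFactors_71, kSum, ← list_range_map_sum]
  decide +kernel

/-! ## §2 The Kurihara number of the newform of `T₀` -/

/-- **`δ̃_{71}(T₀) ≢ 0 (mod 5)` from modularity of `709a1` by name.** For every modular parametrisation datum
`D` of `T₀` at a level equal to `34741`: the table logarithm `ψ` is surjective and `kuriharaNumber D.f 5 71 ψ ≠ 0`. [cite: Kim2022StructureSelmer, §1.4.3] [cite: MazurTateTeitelbaum1986Invent, §I.8] -/
theorem exists_kuriharaNumber_ne_zero_T0 (hnf : exists_isNewformOf) (N : ℕ) (hN : N = 34741) [NeZero N]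
    (D : haveI := C709a1.minTwist7_isElliptic; ModularParametrizationData T0 N) :
    ∃ ψ : (ℓ : ℕ) → (ZMod ℓ)ˣ →* Multiplicative (ZMod 5),
      (∀ ℓ ∈ (71 : ℕ).primeFactors, Function.Surjective (ψ ℓ)) ∧ kuriharaNumber D.f 5 71 ψ ≠ 0 := by
  subst hN
  haveI := C709a1.minTwist7_isElliptic
  haveI := C709a1.minTwist7_isGloballyMinimal
  haveI := isElliptic_c709a1
  haveI := isGloballyMinimal_c709a1
  haveI : Fact (Nat.Prime 5) := ⟨by norm_num⟩
  haveI : NeZero (71 : ℕ) := ⟨by norm_num⟩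
  have hg := D.isNewformOf
  obtain ⟨C, hCall, hCval⟩ := exists_const_T0 hnf D.f hg
  -- `|C|₅ ≥ 1`: `C k = 1/2`
  obtain ⟨k, hk⟩ := exists_mul_eq_half D.f hg.1 hg.coeffField_eq_bot hCall
  -- `|C|₅ ≤ 1`: integrality at `2/71`, `sigmaT 2 = -1`; `T₀[5]` irreducible, transported through the twist
  have hirrE : (((⟨0, -1, 1, -2, 0⟩ : WeierstrassCurve ℤ).map (Int.castRingHom ℚ))).HasIrreducibleModPGaloisRep 5 :=
    hasIrreducibleModPGaloisRep_of_hasSurjectiveModNGaloisRep _ 5 C709a1.hasSurjectiveModNGaloisRep_5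
  have hirr : T0.HasIrreducibleModPGaloisRep 5 :=
    hasIrreducibleModPGaloisRep_of_smul_eq_quadraticTwist (((⟨0, -1, 1, -2, 0⟩ : WeierstrassCurve ℤ).map (Int.castRingHom ℚ))) T0 5 (d := -7) (by norm_num)
      C709a1.minTwist7_smul_eq hirrE
  have hle : ‖((ratPlusSymbol D.f (((2 : ℕ) : ℚ) / 71) : ℚ) : ℚ_[5])‖ ≤ 1 := by
    refine IsNewformOf.norm_ratPlusSymbol_le_one hg (by norm_num) hirr ?_
    have hden : (((2 : ℕ) : ℚ) / 71).den = 71 := by norm_num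
    rw [hden]; norm_num
  rw [hCval 2 (by norm_num) (by norm_num), sigmaT_witness] at hle
  -- hence `|C|₅ = 1`
  have h2 : ‖(2 : ℚ_[5])‖ = 1 := by
    have := (Padic.norm_natCast_eq_one_iff (p := 5) (n := 2)).mpr (by norm_num)
    simpa using this
  have hv : ‖(((-1 : ℤ) : ℚ) : ℚ_[5])‖ = 1 := by
    have := (Padic.norm_natCast_eq_one_iff (p := 5) (n := 1)).mpr (by norm_num)
    rw [show (((-1 : ℤ) : ℚ) : ℚ_[5]) = -(((1 : ℕ) : ℚ_[5])) by push_cast; ring, norm_neg]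
    exact this
  have hle' : ‖(C : ℚ_[5])‖ ≤ 1 := by
    have e : ((C * ((-1 : ℤ) : ℚ) : ℚ) : ℚ_[5]) = (C : ℚ_[5]) * (((-1 : ℤ) : ℚ) : ℚ_[5]) := by push_cast; ring
    rw [e, norm_mul, hv, mul_one] at hle
    exact hle
  have hk1 : ‖((k : ℤ) : ℚ_[5])‖ ≤ 1 := Padic.norm_int_le_one k
  have hprod : ‖(C : ℚ_[5])‖ * ‖((k : ℤ) : ℚ_[5])‖ = 1 := by
    have e : ((C * k : ℚ) : ℚ_[5]) = (C : ℚ_[5]) * ((k : ℤ) : ℚ_[5]) := by push_cast; ring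
    rw [← norm_mul, ← e, hk]
    push_cast
    rw [norm_div, norm_one, h2]; norm_num
  have hC5 : ‖(C : ℚ_[5])‖ = 1 := by
    apply le_antisymm hle'
    nlinarith [norm_nonneg (C : ℚ_[5]), norm_nonneg ((k : ℤ) : ℚ_[5])]
  -- so numerator and denominator of `C` are prime to `5`
  have hCq : (C : ℚ_[5]) = ((C.num : ℤ) : ℚ_[5]) / ((C.den : ℕ) : ℚ_[5]) := by
    rw [← Rat.cast_intCast, ← Rat.cast_natCast, ← Rat.cast_div, Rat.num_div_den]
  have hdpos : 0 < ‖((C.den : ℕ) : ℚ_[5])‖ := norm_pos_iff.mpr (by exact_mod_cast C.den_ne_zero)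
  have hC5' : ‖((C.num : ℤ) : ℚ_[5])‖ = ‖((C.den : ℕ) : ℚ_[5])‖ := by
    rw [hCq, norm_div, div_eq_one_iff_eq hdpos.ne'] at hC5
    exact hC5
  have hden : ¬ 5 ∣ C.den := fun h => by
    have hlt : ‖((C.den : ℕ) : ℚ_[5])‖ < 1 := Padic.norm_natCast_lt_one_iff.mpr h
    have hnumlt : ‖((C.num : ℤ) : ℚ_[5])‖ < 1 := by rw [hC5']; exact hlt
    have h5num : (5 : ℤ) ∣ C.num := Padic.norm_intCast_lt_one_iff.mp hnumlt
    have hg5 : (5 : ℕ) ∣ Nat.gcd C.num.natAbs C.den := Nat.dvd_gcd (Int.natAbs_dvd_natAbs.mpr h5num) h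
    rw [C.reduced] at hg5
    omega
  have hnum : ¬ (5 : ℤ) ∣ C.num := fun h => by
    have hlt : ‖((C.num : ℤ) : ℚ_[5])‖ < 1 := Padic.norm_intCast_lt_one_iff.mpr h
    have hden1 : ‖((C.den : ℕ) : ℚ_[5])‖ = 1 :=
      Padic.norm_natCast_eq_one_iff.mpr ((Nat.Prime.coprime_iff_not_dvd (by norm_num)).mpr hden)
    rw [hden1] at hC5'
    linarith
  refine ⟨tabFamily 5 T71 T71_ok, fun ℓ hℓ =>
    surjective_tabFamily 5 T71 T71_ok (Nat.prime_of_mem_primeFactors hℓ) (T71_surj ℓ hℓ), ?_⟩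
  exact kuriharaNumber_ne_zero_of_const D.f 5 71 (by norm_num) T71 T71_ok sigmaT C hnum hden
    (fun a ha hac => hCval a ha hac) kSumT_ne_zero

end Summit.BirchSwinnertonDyer.BirchSwinnertonDyer.Theorems.KolyvaginDepthDoor.MSymbolCert.Cert709a1

/-! ## §3 The row: both claims discharged -/

namespace Summit.BirchSwinnertonDyer.BirchSwinnertonDyer.Theorems.KolyvaginDepthDoor

open WeierstrassCurve NumberField IsDedekindDomain
open Summit.BirchSwinnertonDyer.BirchSwinnertonDyer.Theorems

namespace C709a1

/-- **THE TWIST-SIDE KURIHARA CLAIM OF ROW `709a1` @ `(5, −7)` FROM MODULARITY BY NAME** (the claim for `T₀` @ `(5, 71)`),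
proved from `exists_isNewformOf` (`MSymbolCert.Cert709a1.exists_kuriharaNumber_ne_zero_T0`, `N(T₀) = 34741`).
[cite: Kim2022StructureSelmer, §1.4.3] [cite: MazurTateTeitelbaum1986Invent, §I.8] -/
theorem kuriharaClaimT_5_71 (hnf : exists_isNewformOf) :
    haveI := minTwist7_isElliptic; haveI := minTwist7_isGloballyMinimal;
      haveI : NeZero (((⟨0, 1, 1, -114, 130⟩ : WeierstrassCurve ℤ).map (Int.castRingHom ℚ)).conductorNorm ℤ) :=
        neZero_conductorNorm_of_isElliptic _;
      haveI := Fact.mk (by norm_num : Nat.Prime 5);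
      ∀ (D : ModularParametrizationData ((⟨0, 1, 1, -114, 130⟩ : WeierstrassCurve ℤ).map (Int.castRingHom ℚ))
          (((⟨0, 1, 1, -114, 130⟩ : WeierstrassCurve ℤ).map (Int.castRingHom ℚ)).conductorNorm ℤ)),
        ¬ ((5 : ℕ) : ℤ) ∣ D.maninConstant →
        (∃ u : ℚ, ‖(u : ℚ_[5])‖ = 1 ∧
          ((⟨0, 1, 1, -114, 130⟩ : WeierstrassCurve ℤ).map (Int.castRingHom ℚ)).realPeriodRat = u * plusPeriod D.f) →
        ∃ ψ : (ℓ : ℕ) → (ZMod ℓ)ˣ →* Multiplicative (ZMod 5),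
          (∀ ℓ ∈ (71 : ℕ).primeFactors, Function.Surjective (ψ ℓ)) ∧ kuriharaNumber D.f 5 71 ψ ≠ 0 := by
  intro D _ _
  haveI := minTwist7_isElliptic
  haveI : NeZero ((((⟨0, 1, 1, -114, 130⟩ : WeierstrassCurve ℤ).map (Int.castRingHom ℚ))).conductorNorm ℤ) := neZero_conductorNorm_of_isElliptic _
  exact MSymbolCert.Cert709a1.exists_kuriharaNumber_ne_zero_T0 hnf _ MSymbolCert.Cert709a1.conductorNorm_T0 D

/-- **DEPTH-TABLE ROW `709a1`, `(p, d_K) = (5, −7)`, v27 — NO COMPUTATIONAL CLAIM LEFT.** For every imaginary quadratic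
`K` with `d_K = −7`: granted Kim's Thm. 1.11 (`hKim`), modularity (`hnf`), Mazur's Cor. 4.1 (`hMaz`) and W. Zhang's
L8.4 (1)/9.1 (`h84`) BY NAME, the clause of the crux `KolyvaginDepthSupplyKN` holds at `W = 709a1` VERBATIM — the row's
assembly theorem with BOTH Kurihara claims PROVED (`kuriharaClaim_5_7171`: kernel-certified plus M-symbol of `709a1`;
`kuriharaClaimT_5_71`: certified minus M-symbol and the twist formula, from `hnf`).
CONDITIONAL on the four named print facts ONLY; per curve; nothing class-wide; BSD is not proved by it.
[cite: Kim2022StructureSelmer, Thm. 1.11 (PDF p. 8)] [cite: WZhang2014, Lemma 8.4 (1) (p. 236), Thm. 9.1 (p. 240)]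
[cite: Mazur1978, Cor. 4.1] [cite: CremonaAlgorithms1997, Table 1 (709a1)] -/
theorem cruxBody_of_print_5_neg7
    (hKim : Kim2022_card_selmerGroup_le_pow_of_kuriharaNumber_ne_zero)
    (hnf : exists_isNewformOf) (hMaz : mazur_not_dvd_maninConstant_of_odd)
    (h84 : Literature.NumberTheory.EllipticCurves.WZhang2014_lemma84_exists_minimal_kolyvaginClass_one_selmerCard)
    (K : Type) [Field K] [NumberField K] (hK : IsImaginaryQuadratic K) (hD : NumberField.discr K = -7) :
    haveI := isElliptic_c709a1; haveI := isGloballyMinimal_c709a1;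
    ∃ (p : ℕ) (hp : Fact p.Prime), 5 ≤ p ∧ ((⟨0, -1, 1, -2, 0⟩ : WeierstrassCurve ℤ).map (Int.castRingHom ℚ)).HasGoodReductionAtPrime p ∧
      ¬ (p : ℤ) ∣ ((⟨0, -1, 1, -2, 0⟩ : WeierstrassCurve ℤ).map (Int.castRingHom ℚ)).frobeniusTrace p ∧
      (∀ n : ℕ, ((⟨0, -1, 1, -2, 0⟩ : WeierstrassCurve ℤ).map (Int.castRingHom ℚ)).HasSurjectiveModNGaloisRep (p ^ n : ℕ)) ∧
      (∀ v : HeightOneSpectrum (𝓞 ℚ), ((⟨0, -1, 1, -2, 0⟩ : WeierstrassCurve ℤ).map (Int.castRingHom ℚ)).HasMultiplicativeReductionAt v →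
        ¬ p ∣ ((⟨0, -1, 1, -2, 0⟩ : WeierstrassCurve ℤ).map (Int.castRingHom ℚ)).ordMinimalDiscriminant v) ∧
      ∃ (K : Type) (_ : Field K) (_ : NumberField K), IsImaginaryQuadratic K ∧
        NumberField.discr K ≠ -3 ∧ NumberField.discr K ≠ -4 ∧
        ∃ (_ : NeZero (((⟨0, -1, 1, -2, 0⟩ : WeierstrassCurve ℤ).map (Int.castRingHom ℚ)).conductorNorm ℤ)),
          SatisfiesHeegnerHypothesis (((⟨0, -1, 1, -2, 0⟩ : WeierstrassCurve ℤ).map (Int.castRingHom ℚ)).conductorNorm ℤ) K ∧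
        ∃ (Dt : ModularParametrizationData ((⟨0, -1, 1, -2, 0⟩ : WeierstrassCurve ℤ).map (Int.castRingHom ℚ)) (((⟨0, -1, 1, -2, 0⟩ : WeierstrassCurve ℤ).map (Int.castRingHom ℚ)).conductorNorm ℤ))
          (β : ℤ) (ι : K →+* ℂ) (n₁ : ℕ) (d : KolyvaginHeegnerData Dt β ι n₁), Squarefree n₁ ∧
          (∀ q ∈ n₁.primeFactors, Zhang2014.IsKolyvaginPrime (((⟨0, -1, 1, -2, 0⟩ : WeierstrassCurve ℤ).map (Int.castRingHom ℚ)).conductorNorm ℤ)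
            ((⟨0, -1, 1, -2, 0⟩ : WeierstrassCurve ℤ).map (Int.castRingHom ℚ)) K p q) ∧
          d.kolyvaginClass hp.out 1 ≠ 0 ∧
          (n₁.primeFactors.card + 1 ≤ ((⟨0, -1, 1, -2, 0⟩ : WeierstrassCurve ℤ).map (Int.castRingHom ℚ)).mordellWeilRank ∨
            (n₁.primeFactors.card ≤ ((⟨0, -1, 1, -2, 0⟩ : WeierstrassCurve ℤ).map (Int.castRingHom ℚ)).mordellWeilRank ∧
              n₁.primeFactors.card + 1 ≤ (((⟨0, -1, 1, -2, 0⟩ : WeierstrassCurve ℤ).map (Int.castRingHom ℚ)).quadraticTwist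
                (NumberField.discr K : ℚ)).mordellWeilRank)) :=
  haveI : NeZero (71 : ℕ) := ⟨by norm_num⟩
  cruxBody_of_twistKuriharaClaim_5_neg7 hKim hnf hMaz h84 K hK hD kuriharaClaim_5_7171 71
    minTwist7_isCyclicKolyvaginLevel_5_71 (by rw [Nat.Prime.primeFactors (by norm_num)]; simp)
    (kuriharaClaimT_5_71 hnf)

end C709a1

end Summit.BirchSwinnertonDyer.BirchSwinnertonDyer.Theorems.KolyvaginDepthDoor

end
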